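import Mathlib
import HarnessLib
import Summits.ResolutionOfSingularities.ResolutionOfSingularities.Theorems.WildQuotientsWildQuotientResolutionS1aCuspResidualOChart
import Summits.ResolutionOfSingularities.ResolutionOfSingularities.Theorems.WildQuotientsWildQuotientResolutionS1aResidualPointTransport
import Summits.ResolutionOfSingularities.ResolutionOfSingularities.Theorems.WildQuotientsWildQuotientResolutionS1aSymSections

/-!
# S1a — R4c cusp COVER brick at `O`, chart `[N(x₂)]`: residual points of `O′₀₂` lie in `D(transition section towards O′₀₁ = [N(x₁)])`

[OURS · L1 W4.5c · leafhand-res-wildquotients-7 g1] — NOT statements of the manuscript; counted 0; AI-level work, weaker than expert review. Crux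
stmt-ResolutionOfSingularities-17941 `CyclicQuotientFourfolds`, line `s1a-logminvertex` v13 (`stub_reachLowerInFX`), R4c `cusp_killsIn_two` (crux-dir skeleton v2,
`Lines/s1a_logminvertex-R4c-PROGRESS-v2.md` COVER obligation 1 at `O`: "`R₀₂ ⊆ O′₀₁`"; hand-7 g0 repair census item (b)).

On the producer chart `[N(x₂)]` over `W_O` (cover element `c ↦ N(x₂′)^{n₂}`) the transition section towards `[N(x₁)]` is `c′/c` with `c′ ↦ N(x₁′)^{n₁}`;
✓`Cusp.cuspO_residual_not_mem_normX₂Chart` (hand 7, p819581) says a residual prime of the free model misses `N(x₁′)`. This file transports it to the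
chart ring (as ✓`KillCert.QhSym.cuspO_norms_not_mem_of_residual`, p820215) and to the scheme (as ✓`cuspO_mem_basicOpen_of_residual`, p820344):
* ★ `cuspO_transition_not_mem_of_residual` — `u₀′/1, t̂/1 ∈ Q` ⇒ `c′/1 ∉ Q` for `c′ = (∏ₗ (u₁′ + l·u₀′s⁷))^{n₁}`;
* ★ `cuspO_transitionSection_not_mem_of_residualSections` — sections form: `c′/1 · (1/c) ∉ Q`;
* ★★ `cuspO_mem_basicOpen_transition_of_residual` — scheme form: every point of `W = O′₀₂` off `D(z₀) ∪ D(z₁)` lies in `D(tr)` for the transition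
  section `E tr = c′/1·(1/c)` (then ✓`mem_blowupChart_of_mem_basicOpen_of_mul_appLE_eq` puts it in `O′₀₁`, and ✓`mem_basicOpen_iff_of_pins` with the pins
  ✓`QhAbs.qha_residualSection_zero_pin` / `_tail_pin` makes it residual there, whence in `U_O` by p820344).
-/

set_option linter.dupNamespace false

noncomputable section

open CategoryTheory AlgebraicGeometry TopologicalSpace Opposite MvPolynomial
open Literature.AlgebraicGeometry.Resolution
open scoped LaurentPolynomial
open Summit.ResolutionOfSingularities.ResolutionOfSingularities.Theorems.WildQuotientResolution.S1
open Summit.ResolutionOfSingularities.ResolutionOfSingularities.Theorems.WildQuotientResolution.S1.CoarseChart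
open Summit.ResolutionOfSingularities.ResolutionOfSingularities.Theorems.WildQuotientResolution.S1.ProducerStep
open Summit.ResolutionOfSingularities.ResolutionOfSingularities.Theorems.WildQuotientResolution.S1.ReesBigrading
open Summit.ResolutionOfSingularities.ResolutionOfSingularities.Theorems.WildQuotientResolution.S1.NodeTransport
open Summit.ResolutionOfSingularities.ResolutionOfSingularities.Theorems.WildQuotientResolution.S1.CobordantTransport
open Summit.ResolutionOfSingularities.ResolutionOfSingularities.Theorems.WildQuotientResolution.S1.NodeAway
open Summit.ResolutionOfSingularities.ResolutionOfSingularities.Theorems.WildQuotientResolution.S1.CentreAway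
open Summit.ResolutionOfSingularities.ResolutionOfSingularities.Theorems.WildQuotientResolution.S1.BlowupCharts
open Summit.ResolutionOfSingularities.ResolutionOfSingularities.Theorems.WildQuotientResolution.S1.KillCert
open Summit.ResolutionOfSingularities.ResolutionOfSingularities.Theorems.WildQuotientResolution.S1.FreeModel
open Summit.ResolutionOfSingularities.ResolutionOfSingularities.Theorems.WildQuotientResolution.S1.GameFrame.GModel

namespace Summit.ResolutionOfSingularities.ResolutionOfSingularities.Theorems.WildQuotientResolution.S1.KillCert.QhSym

variable {k : Type} [Field k] (σ : (MvPolynomial (Fin 4) k) ≃+* (MvPolynomial (Fin 4) k)) (hC : ∀ a : k, σ (C a) = C a)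
  (h0 : σ (X 0) = X 0) (h1 : σ (X 1) = X 1 + X 0) (h2 : σ (X 2) = X 2 + X 0) (h3 : σ (X 3) = X 3 + (X 2 ^ 2 - X 1 ^ 3))
  (hh : (MvPolynomial (Fin 4) k)) (hσh : σ hh = hh)
  {p : ℕ} (hp : 0 < p) (hσpL : ∀ y : (Localization.Away hh), (⇑(sigmaAway σ hσh))^[p] y = y)
  (hσJ : ∀ n : ℕ, ((weightedFiltration (fun i => algebraMap (MvPolynomial (Fin 4) k) (Localization.Away hh) (X ((![0, 1, 2] : Fin 3 → Fin 4) i))) (![9, 2, 3] : Fin 3 → ℕ)).ideal n).map ((sigmaAway σ hσh) : (Localization.Away hh) →+* (Localization.Away hh)) ≤ (weightedFiltration (fun i => algebraMap (MvPolynomial (Fin 4) k) (Localization.Away hh) (X ((![0, 1, 2] : Fin 3 → Fin 4) i))) (![9, 2, 3] : Fin 3 → ℕ)).ideal n)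
  (ht : algebraMap (MvPolynomial (Fin 4) k) (Localization.Away hh) (X 2 ^ 2 - X 1 ^ 3) ∈ (weightedFiltration (fun i => algebraMap (MvPolynomial (Fin 4) k) (Localization.Away hh) (X ((![0, 1, 2] : Fin 3 → Fin 4) i))) (![9, 2, 3] : Fin 3 → ℕ)).ideal 6)
  {mg : ℕ} (mo : Fin mg → ℕ) (𝒜 : (Π j : Fin mg, ZMod (mo j)) → AddSubgroup (Localization.Away hh)) [GradedRing 𝒜]
  (hf : ∀ i, (fun i => algebraMap (MvPolynomial (Fin 4) k) (Localization.Away hh) (X ((![0, 1, 2] : Fin 3 → Fin 4) i))) i ∈ 𝒜 ((fun _ => (0 : Π j : Fin mg, ZMod (mo j))) i))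
  {dbar : ℕ} (y : ↥(𝒜 0)) (hy : y ∈ (traceFiltration 𝒜 (fun i => algebraMap (MvPolynomial (Fin 4) k) (Localization.Away hh) (X ((![0, 1, 2] : Fin 3 → Fin 4) i))) (![9, 2, 3] : Fin 3 → ℕ)).ideal dbar) (hσy : (sigmaAway σ hσh) (y : (Localization.Away hh)) = y)
  (y' : ↥(𝒜 0)) (hy' : y' ∈ (traceFiltration 𝒜 (fun i => algebraMap (MvPolynomial (Fin 4) k) (Localization.Away hh) (X ((![0, 1, 2] : Fin 3 → Fin 4) i))) (![9, 2, 3] : Fin 3 → ℕ)).ideal dbar)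

set_option maxHeartbeats 1600000 in
set_option synthInstance.maxHeartbeats 400000 in
/-- ★ **Residual primes of the chart ring `[N(x₂)]` at `O` miss the cover element of `[N(x₁)]`.** Let `Φ : R_c ≃ k[s,x′][1/q]` be a pinned model of a
producer chart ring over `W_O` inverting `subst hh` and `N(x₂′)`, and `Q ⊂ R_c` a prime containing `u₀′/1` and `t̂/1`. Then `c′/1 ∉ Q` for every cover
element `c′ = (∏ₗ (u₁′ + l·u₀′s⁷))^{n₁}` of the neighbouring chart `[N(x₁)]`. [OURS · L1 W4.5c · R4c (C1)/(b) at `O`] -/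
theorem cuspO_transition_not_mem_of_residual [NeZero p]
    {qd : MvPolynomial (Option (Fin 4)) k} (hq0 : qd ≠ 0) (Φ : (ChartRing 𝒜 (fun i => algebraMap (MvPolynomial (Fin 4) k) (Localization.Away hh) (X ((![0, 1, 2] : Fin 3 → Fin 4) i))) (![9, 2, 3] : Fin 3 → ℕ) dbar y hy) ≃+* Localization.Away qd)
    (hΦa : ∀ a : (MvPolynomial (Fin 4) k), Φ ((algebraMap ↥(cobordantAlgebra (fun i => algebraMap (MvPolynomial (Fin 4) k) (Localization.Away hh) (X ((![0, 1, 2] : Fin 3 → Fin 4) i))) (![9, 2, 3] : Fin 3 → ℕ)) (ChartRing 𝒜 (fun i => algebraMap (MvPolynomial (Fin 4) k) (Localization.Away hh) (X ((![0, 1, 2] : Fin 3 → Fin 4) i))) (![9, 2, 3] : Fin 3 → ℕ) dbar y hy)) (algebraMap (Localization.Away hh) ↥(cobordantAlgebra (fun i => algebraMap (MvPolynomial (Fin 4) k) (Localization.Away hh) (X ((![0, 1, 2] : Fin 3 → Fin 4) i))) (![9, 2, 3] : Fin 3 → ℕ)) (algebraMap (MvPolynomial (Fin 4) k) (Localization.Away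 hh) a))) = (algebraMap (MvPolynomial (Option (Fin 4)) k) (Localization.Away qd)) (cobordantAlgebra.subst k (![9, 2, 3, 0] : Fin 4 → ℕ) a))
    (hΦs : Φ ((algebraMap ↥(cobordantAlgebra (fun i => algebraMap (MvPolynomial (Fin 4) k) (Localization.Away hh) (X ((![0, 1, 2] : Fin 3 → Fin 4) i))) (![9, 2, 3] : Fin 3 → ℕ)) (ChartRing 𝒜 (fun i => algebraMap (MvPolynomial (Fin 4) k) (Localization.Away hh) (X ((![0, 1, 2] : Fin 3 → Fin 4) i))) (![9, 2, 3] : Fin 3 → ℕ) dbar y hy)) (cobordantAlgebra.s (fun i => algebraMap (MvPolynomial (Fin 4) k) (Localization.Away hh) (X ((![0, 1, 2] : Fin 3 → Fin 4) i))) (![9, 2, 3] : Fin 3 → ℕ))) = (algebraMap (MvPolynomial (Option (Fin 4)) k) (Localization.Away qd)) (X none))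
    (hΦu : ∀ i : Fin 3, Φ ((algebraMap ↥(cobordantAlgebra (fun i => algebraMap (MvPolynomial (Fin 4) k) (Localization.Away hh) (X ((![0, 1, 2] : Fin 3 → Fin 4) i))) (![9, 2, 3] : Fin 3 → ℕ)) (ChartRing 𝒜 (fun i => algebraMap (MvPolynomial (Fin 4) k) (Localization.Away hh) (X ((![0, 1, 2] : Fin 3 → Fin 4) i))) (![9, 2, 3] : Fin 3 → ℕ) dbar y hy)) (cobordantAlgebra.u' (fun i => algebraMap (MvPolynomial (Fin 4) k) (Localization.Away hh) (X ((![0, 1, 2] : Fin 3 → Fin 4) i))) (![9, 2, 3] : Fin 3 → ℕ) i)) = (algebraMap (MvPolynomial (Option (Fin 4)) k) (Localization.Away qd)) (X (some ((![0, 1, 2] : Fin 3 → Fin 4) i))))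
    (hUN2 : IsUnit ((algebraMap (MvPolynomial (Option (Fin 4)) k) (Localization.Away qd)) (∏ l : ZMod p, (X (some 2) + (l.val : (MvPolynomial (Option (Fin 4)) k)) * (X none ^ 6 * X (some 0))))))
    {n₁ : ℕ} (hc1 : (coverElement 𝒜 (fun i => algebraMap (MvPolynomial (Fin 4) k) (Localization.Away hh) (X ((![0, 1, 2] : Fin 3 → Fin 4) i))) (![9, 2, 3] : Fin 3 → ℕ) dbar y' hy') = (∏ l : ZMod p, ((cobordantAlgebra.u' (fun i => algebraMap (MvPolynomial (Fin 4) k) (Localization.Away hh) (X ((![0, 1, 2] : Fin 3 → Fin 4) i))) (![9, 2, 3] : Fin 3 → ℕ) 1) + algebraMap (Localization.Away hh) ↥(cobordantAlgebra (fun i => algebraMap (MvPolynomial (Fin 4) k) (Localization.Away hh) (X ((![0, 1, 2] : Fin 3 → Fin 4) i))) (![9, 2, 3] : Fin 3 → ℕ)) (l.val : (Localization.Away hh)) * ((cobordantAlgebra.u' (fun i => algebraMap (MvPolynomial (Fin 4) k) (Localization.Away hh) (X ((![0, 1, 2] : Fin 3 → Fin 4) i))) (![9, 2, 3] : Fin 3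 → ℕ) 0) * (cobordantAlgebra.s (fun i => algebraMap (MvPolynomial (Fin 4) k) (Localization.Away hh) (X ((![0, 1, 2] : Fin 3 → Fin 4) i))) (![9, 2, 3] : Fin 3 → ℕ)) ^ ((![9, 2, 3] : Fin 3 → ℕ) 0 - (![9, 2, 3] : Fin 3 → ℕ) 1)))) ^ n₁)
    (Q : Ideal (ChartRing 𝒜 (fun i => algebraMap (MvPolynomial (Fin 4) k) (Localization.Away hh) (X ((![0, 1, 2] : Fin 3 → Fin 4) i))) (![9, 2, 3] : Fin 3 → ℕ) dbar y hy)) [hQ : Q.IsPrime]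
    (hu0 : (algebraMap ↥(cobordantAlgebra (fun i => algebraMap (MvPolynomial (Fin 4) k) (Localization.Away hh) (X ((![0, 1, 2] : Fin 3 → Fin 4) i))) (![9, 2, 3] : Fin 3 → ℕ)) (ChartRing 𝒜 (fun i => algebraMap (MvPolynomial (Fin 4) k) (Localization.Away hh) (X ((![0, 1, 2] : Fin 3 → Fin 4) i))) (![9, 2, 3] : Fin 3 → ℕ) dbar y hy)) (cobordantAlgebra.u' (fun i => algebraMap (MvPolynomial (Fin 4) k) (Localization.Away hh) (X ((![0, 1, 2] : Fin 3 → Fin 4) i))) (![9, 2, 3] : Fin 3 → ℕ) 0) ∈ Q)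
    (htt : (algebraMap ↥(cobordantAlgebra (fun i => algebraMap (MvPolynomial (Fin 4) k) (Localization.Away hh) (X ((![0, 1, 2] : Fin 3 → Fin 4) i))) (![9, 2, 3] : Fin 3 → ℕ)) (ChartRing 𝒜 (fun i => algebraMap (MvPolynomial (Fin 4) k) (Localization.Away hh) (X ((![0, 1, 2] : Fin 3 → Fin 4) i))) (![9, 2, 3] : Fin 3 → ℕ) dbar y hy)) ⟨_, C_mul_T_mem_cobordantAlgebra _ _ ht⟩ ∈ Q) :
    (algebraMap ↥(cobordantAlgebra (fun i => algebraMap (MvPolynomial (Fin 4) k) (Localization.Away hh) (X ((![0, 1, 2] : Fin 3 → Fin 4) i))) (![9, 2, 3] : Fin 3 → ℕ)) (ChartRing 𝒜 (fun i => algebraMap (MvPolynomial (Fin 4) k) (Localization.Away hh) (X ((![0, 1, 2] : Fin 3 → Fin 4) i))) (![9, 2, 3] : Fin 3 → ℕ) dbar y hy)) (coverElement 𝒜 (fun i => algebraMap (MvPolynomial (Fin 4) k) (Localization.Away hh) (X ((![0, 1, 2] : Fin 3 → Fin 4) i))) (![9, 2, 3] : Fin 3 → ℕ) dbar y' hy')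 ∉ Q := by
  have he7 : (![9, 2, 3] : Fin 3 → ℕ) 0 - (![9, 2, 3] : Fin 3 → ℕ) 1 = 7 := by decide
  -- ### the transported primes
  let Q' : Ideal (Localization.Away qd) := Q.comap Φ.symm
  haveI hQ' : Q'.IsPrime := Ideal.IsPrime.comap Φ.symm
  let Q'' : Ideal (MvPolynomial (Option (Fin 4)) k) := Q'.comap (algebraMap (MvPolynomial (Option (Fin 4)) k) (Localization.Away qd))
  haveI hQ'' : Q''.IsPrime := Ideal.IsPrime.comap _
  have hiff : ∀ x : (ChartRing 𝒜 (fun i => algebraMap (MvPolynomial (Fin 4) k) (Localization.Away hh) (X ((![0, 1, 2] : Fin 3 → Fin 4) i))) (![9, 2, 3] : Fin 3 → ℕ) dbar y hy), x ∈ Q ↔ Φ x ∈ Q' := fun x => by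
    change x ∈ Q ↔ Φ x ∈ Q.comap Φ.symm
    rw [Ideal.mem_comap, RingEquiv.symm_apply_apply]
  have hiffM : ∀ m : (MvPolynomial (Option (Fin 4)) k), m ∈ Q'' ↔ (algebraMap (MvPolynomial (Option (Fin 4)) k) (Localization.Away qd)) m ∈ Q' := fun m => Ideal.mem_comap
  have hnu : ∀ m : (MvPolynomial (Option (Fin 4)) k), IsUnit ((algebraMap (MvPolynomial (Option (Fin 4)) k) (Localization.Away qd)) m) → m ∉ Q'' := fun m hm hmQ =>
    hQ'.ne_top (Q'.eq_top_of_isUnit_mem ((hiffM m).mp hmQ) hm)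
  -- ### residual generators in the model
  have hu0' := hΦu 0
  change _ = (algebraMap (MvPolynomial (Option (Fin 4)) k) (Localization.Away qd)) (X (some 0)) at hu0'
  have hu1' := hΦu 1
  change _ = (algebraMap (MvPolynomial (Option (Fin 4)) k) (Localization.Away qd)) (X (some 1)) at hu1'
  have hX₀ : (X (some 0) : (MvPolynomial (Option (Fin 4)) k)) ∈ Q'' := by
    rw [hiffM, ← hu0']
    exact (hiff _).mp hu0
  have hφ : (X (some 2) ^ 2 - X (some 1) ^ 3 : (MvPolynomial (Option (Fin 4)) k)) ∈ Q'' := by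
    rw [hiffM, ← KillCert.QhAway.qhc_tail_eq (X 2 ^ 2 - X 1 ^ 3) (![9, 2, 3] : Fin 3 → ℕ) 6 hh mo 𝒜 y hy hq0 Φ hΦa hΦs ht (X (some 2) ^ 2 - X (some 1) ^ 3 : (MvPolynomial (Option (Fin 4)) k)) (KillCert.QhSym.subst_cuspTail (k := k))]
    exact (hiff _).mp htt
  obtain ⟨-, -, hN₁⟩ := Cusp.cuspO_residual_not_mem_normX₂Chart (p := p) Q'' hX₀ hφ (hnu _ hUN2)
  -- ### `Φ (c′/1) = N(x₁′)^n₁ / 1`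
  have heq : Φ ((algebraMap ↥(cobordantAlgebra (fun i => algebraMap (MvPolynomial (Fin 4) k) (Localization.Away hh) (X ((![0, 1, 2] : Fin 3 → Fin 4) i))) (![9, 2, 3] : Fin 3 → ℕ)) (ChartRing 𝒜 (fun i => algebraMap (MvPolynomial (Fin 4) k) (Localization.Away hh) (X ((![0, 1, 2] : Fin 3 → Fin 4) i))) (![9, 2, 3] : Fin 3 → ℕ) dbar y hy)) (coverElement 𝒜 (fun i => algebraMap (MvPolynomial (Fin 4) k) (Localization.Away hh) (X ((![0, 1, 2] : Fin 3 → Fin 4) i))) (![9, 2, 3] : Fin 3 → ℕ) dbar y' hy')) = (algebraMap (MvPolynomial (Option (Fin 4)) k) (Localization.Away qd)) ((∏ l : ZMod p, (X (some 1) + (l.val : (MvPolynomial (Option (Fin 4)) k)) * (X none ^ 6 * (X (some 0) * X none ^ 1)))) ^ n₁) := by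
    rw [hc1, he7]
    simp only [map_pow, map_prod]
    refine congrArg (· ^ n₁) (Finset.prod_congr rfl fun l _ => ?_)
    simp only [map_add, map_mul, map_pow, map_natCast, hu0', hu1', hΦs]
    ring
  intro h
  have h' := (hiff _).mp h
  rw [heq] at h'
  exact hN₁ (hQ''.mem_of_pow_mem n₁ ((hiffM _).mpr h'))

set_option maxHeartbeats 1600000 in
set_option synthInstance.maxHeartbeats 400000 in
/-- ★ **The transition section `c′/c` of `[N(x₂)] → [N(x₁)]` at `O` is not in a residual prime** (sections form of `cuspO_transition_not_mem_of_residual`: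
hypotheses = the residual SECTIONS `u₀′^{n₀}/c`, `t̂ⁿ/c ∈ Q`). [OURS · L1 W4.5c · R4c (C1)/(b) at `O`] -/
theorem cuspO_transitionSection_not_mem_of_residualSections [NeZero p]
    {qd : MvPolynomial (Option (Fin 4)) k} (hq0 : qd ≠ 0) (Φ : (ChartRing 𝒜 (fun i => algebraMap (MvPolynomial (Fin 4) k) (Localization.Away hh) (X ((![0, 1, 2] : Fin 3 → Fin 4) i))) (![9, 2, 3] : Fin 3 → ℕ) dbar y hy) ≃+* Localization.Away qd)
    (hΦa : ∀ a : (MvPolynomial (Fin 4) k), Φ ((algebraMap ↥(cobordantAlgebra (fun i => algebraMap (MvPolynomial (Fin 4) k) (Localization.Away hh) (X ((![0, 1, 2] : Fin 3 → Fin 4) i))) (![9, 2, 3] : Fin 3 → ℕ)) (ChartRing 𝒜 (fun i => algebraMap (MvPolynomial (Fin 4) k) (Localization.Away hh) (X ((![0, 1, 2] : Fin 3 → Fin 4) i))) (![9, 2, 3] : Fin 3 → ℕ) dbar y hy)) (algebraMap (Localization.Away hh) ↥(cobordantAlgebra (fun i => algebraMap (MvPolynomial (Fin 4) k) (Localization.Away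 hh) (X ((![0, 1, 2] : Fin 3 → Fin 4) i))) (![9, 2, 3] : Fin 3 → ℕ)) (algebraMap (MvPolynomial (Fin 4) k) (Localization.Away hh) a))) = (algebraMap (MvPolynomial (Option (Fin 4)) k) (Localization.Away qd)) (cobordantAlgebra.subst k (![9, 2, 3, 0] : Fin 4 → ℕ) a))
    (hΦs : Φ ((algebraMap ↥(cobordantAlgebra (fun i => algebraMap (MvPolynomial (Fin 4) k) (Localization.Away hh) (X ((![0, 1, 2] : Fin 3 → Fin 4) i))) (![9, 2, 3] : Fin 3 → ℕ)) (ChartRing 𝒜 (fun i => algebraMap (MvPolynomial (Fin 4) k) (Localization.Away hh) (X ((![0, 1, 2] : Fin 3 → Fin 4) i))) (![9, 2, 3] : Fin 3 → ℕ) dbar y hy)) (cobordantAlgebra.s (fun i => algebraMap (MvPolynomial (Fin 4) k) (Localization.Away hh) (X ((![0, 1, 2] : Fin 3 → Fin 4) i))) (![9, 2, 3] : Fin 3 → ℕ))) = (algebraMap (MvPolynomial (Option (Fin 4)) k) (Localization.Away qd)) (X none))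
    (hΦu : ∀ i : Fin 3, Φ ((algebraMap ↥(cobordantAlgebra (fun i => algebraMap (MvPolynomial (Fin 4) k) (Localization.Away hh) (X ((![0, 1, 2] : Fin 3 → Fin 4) i))) (![9, 2, 3] : Fin 3 → ℕ)) (ChartRing 𝒜 (fun i => algebraMap (MvPolynomial (Fin 4) k) (Localization.Away hh) (X ((![0, 1, 2] : Fin 3 → Fin 4) i))) (![9, 2, 3] : Fin 3 → ℕ) dbar y hy)) (cobordantAlgebra.u' (fun i => algebraMap (MvPolynomial (Fin 4) k) (Localization.Away hh) (X ((![0, 1, 2] : Fin 3 → Fin 4) i))) (![9, 2, 3] : Fin 3 → ℕ) i)) = (algebraMap (MvPolynomial (Option (Fin 4)) k) (Localization.Away qd)) (X (some ((![0, 1, 2] : Fin 3 → Fin 4) i))))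
    (hUN2 : IsUnit ((algebraMap (MvPolynomial (Option (Fin 4)) k) (Localization.Away qd)) (∏ l : ZMod p, (X (some 2) + (l.val : (MvPolynomial (Option (Fin 4)) k)) * (X none ^ 6 * X (some 0))))))
    {n₁ : ℕ} (hc1 : (coverElement 𝒜 (fun i => algebraMap (MvPolynomial (Fin 4) k) (Localization.Away hh) (X ((![0, 1, 2] : Fin 3 → Fin 4) i))) (![9, 2, 3] : Fin 3 → ℕ) dbar y' hy') = (∏ l : ZMod p, ((cobordantAlgebra.u' (fun i => algebraMap (MvPolynomial (Fin 4) k) (Localization.Away hh) (X ((![0, 1, 2] : Fin 3 → Fin 4) i))) (![9, 2, 3] : Fin 3 → ℕ) 1) + algebraMap (Localization.Away hh) ↥(cobordantAlgebra (fun i => algebraMap (MvPolynomial (Fin 4) k) (Localization.Away hh) (X ((![0, 1, 2] : Fin 3 → Fin 4) i))) (![9, 2, 3] : Fin 3 → ℕ)) (l.val : (Localization.Away hh)) * ((cobordantAlgebra.u' (fun i => algebraMap (MvPolynomial (Fin 4) k) (Localization.Away hh) (X ((![0, 1, 2] : Fin 3 → Fin 4) i))) (![9, 2, 3] : Fin 3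 → ℕ) 0) * (cobordantAlgebra.s (fun i => algebraMap (MvPolynomial (Fin 4) k) (Localization.Away hh) (X ((![0, 1, 2] : Fin 3 → Fin 4) i))) (![9, 2, 3] : Fin 3 → ℕ)) ^ ((![9, 2, 3] : Fin 3 → ℕ) 0 - (![9, 2, 3] : Fin 3 → ℕ) 1)))) ^ n₁)
    (Q : Ideal (ChartRing 𝒜 (fun i => algebraMap (MvPolynomial (Fin 4) k) (Localization.Away hh) (X ((![0, 1, 2] : Fin 3 → Fin 4) i))) (![9, 2, 3] : Fin 3 → ℕ) dbar y hy)) [hQ : Q.IsPrime]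
    {n₀ n : ℕ} (hn₀ : 0 < n₀) (hn : 0 < n)
    (h0sec : (algebraMap ↥(cobordantAlgebra (fun i => algebraMap (MvPolynomial (Fin 4) k) (Localization.Away hh) (X ((![0, 1, 2] : Fin 3 → Fin 4) i))) (![9, 2, 3] : Fin 3 → ℕ)) (ChartRing 𝒜 (fun i => algebraMap (MvPolynomial (Fin 4) k) (Localization.Away hh) (X ((![0, 1, 2] : Fin 3 → Fin 4) i))) (![9, 2, 3] : Fin 3 → ℕ) dbar y hy)) ((cobordantAlgebra.u' (fun i => algebraMap (MvPolynomial (Fin 4) k) (Localization.Away hh) (X ((![0, 1, 2] : Fin 3 → Fin 4) i))) (![9, 2, 3] : Fin 3 → ℕ) 0) ^ n₀) * IsLocalization.Away.invSelf (coverElement 𝒜 (fun i => algebraMap (MvPolynomial (Fin 4) k) (Localization.Away hh) (X ((![0, 1, 2] : Fin 3 → Fin 4) i))) (![9, 2, 3] : Fin 3 → ℕ) dbar y hy) ∈ Q)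
    (h1sec : (algebraMap ↥(cobordantAlgebra (fun i => algebraMap (MvPolynomial (Fin 4) k) (Localization.Away hh) (X ((![0, 1, 2] : Fin 3 → Fin 4) i))) (![9, 2, 3] : Fin 3 → ℕ)) (ChartRing 𝒜 (fun i => algebraMap (MvPolynomial (Fin 4) k) (Localization.Away hh) (X ((![0, 1, 2] : Fin 3 → Fin 4) i))) (![9, 2, 3] : Fin 3 → ℕ) dbar y hy)) (((⟨_, C_mul_T_mem_cobordantAlgebra _ _ ht⟩ : ↥(cobordantAlgebra (fun i => algebraMap (MvPolynomial (Fin 4) k) (Localization.Away hh) (X ((![0, 1, 2] : Fin 3 → Fin 4) i))) (![9, 2, 3] : Fin 3 → ℕ)))) ^ n) * IsLocalization.Away.invSelf (coverElement 𝒜 (fun i => algebraMap (MvPolynomial (Fin 4) k) (Localization.Away hh) (X ((![0, 1, 2] : Fin 3 → Fin 4) i))) (![9, 2, 3] : Fin 3 → ℕ) dbar y hy) ∈ Q) :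
    (algebraMap ↥(cobordantAlgebra (fun i => algebraMap (MvPolynomial (Fin 4) k) (Localization.Away hh) (X ((![0, 1, 2] : Fin 3 → Fin 4) i))) (![9, 2, 3] : Fin 3 → ℕ)) (ChartRing 𝒜 (fun i => algebraMap (MvPolynomial (Fin 4) k) (Localization.Away hh) (X ((![0, 1, 2] : Fin 3 → Fin 4) i))) (![9, 2, 3] : Fin 3 → ℕ) dbar y hy)) (coverElement 𝒜 (fun i => algebraMap (MvPolynomial (Fin 4) k) (Localization.Away hh) (X ((![0, 1, 2] : Fin 3 → Fin 4) i))) (![9, 2, 3] : Fin 3 → ℕ) dbar y' hy') * IsLocalization.Away.invSelf (coverElement 𝒜 (fun i => algebraMap (MvPolynomial (Fin 4) k) (Localization.Away hh) (X ((![0, 1, 2] : Fin 3 → Fin 4) i))) (![9, 2, 3] : Fin 3 → ℕ) dbar y hy) ∉ Q := by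
  obtain ⟨hu0, htt⟩ := QhAbs.mem_of_residualSections_mem (fun i => algebraMap (MvPolynomial (Fin 4) k) (Localization.Away hh) (X ((![0, 1, 2] : Fin 3 → Fin 4) i))) (algebraMap (MvPolynomial (Fin 4) k) (Localization.Away hh) (X 2 ^ 2 - X 1 ^ 3)) (![9, 2, 3] : Fin 3 → ℕ) 6 ht mo 𝒜 y hy n₀ n Q h0sec h1sec hn₀ hn
  have hc' := cuspO_transition_not_mem_of_residual (hh := hh) (ht := ht) (mo := mo) (𝒜 := 𝒜) (y := y) (hy := hy) (y' := y') (hy' := hy') hq0 Φ hΦa hΦs hΦu hUN2 hc1 Q hu0 htt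
  have hunit : IsUnit (IsLocalization.Away.invSelf (S := (ChartRing 𝒜 (fun i => algebraMap (MvPolynomial (Fin 4) k) (Localization.Away hh) (X ((![0, 1, 2] : Fin 3 → Fin 4) i))) (![9, 2, 3] : Fin 3 → ℕ) dbar y hy)) (coverElement 𝒜 (fun i => algebraMap (MvPolynomial (Fin 4) k) (Localization.Away hh) (X ((![0, 1, 2] : Fin 3 → Fin 4) i))) (![9, 2, 3] : Fin 3 → ℕ) dbar y hy)) :=
    IsUnit.of_mul_eq_one (algebraMap _ (ChartRing 𝒜 (fun i => algebraMap (MvPolynomial (Fin 4) k) (Localization.Away hh) (X ((![0, 1, 2] : Fin 3 → Fin 4) i))) (![9, 2, 3] : Fin 3 → ℕ) dbar y hy) (coverElement 𝒜 (fun i => algebraMap (MvPolynomial (Fin 4) k) (Localization.Away hh) (X ((![0, 1, 2] : Fin 3 → Fin 4) i))) (![9, 2, 3] : Fin 3 → ℕ) dbar y hy)) (by rw [mul_comm]; exact IsLocalization.Away.mul_invSelf _)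
  intro h
  rcases hQ.mem_or_mem h with h | h
  · exact hc' h
  · exact hQ.ne_top (Q.eq_top_of_isUnit_mem h hunit)

set_option maxHeartbeats 4000000 in
set_option synthInstance.maxHeartbeats 400000 in
/-- ★★ **COVER step (b) at `O`: the residual points of the producer chart `[N(x₂)]` lie in `D(tr)`, `tr` the transition section towards `[N(x₁)]`.**
On a producer chart `W` over `W_O` with cover element `c ↦ N(x₂′)^{n₂}` (`n₂ > 0`; hypothesis `hc2`) and pinned chart iso `E : Γ(V, W) ≃ (R_c)₀`, let
`tr ∈ Γ(V, W)` have chart value `E tr = c′/1 · (1/c)` with `c′ = (∏ₗ(u₁′ + l·u₀′s⁷))^{n₁}` the cover element of the neighbouring chart `[N(x₁)]` (as the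
move atlas exports it, ✓`transitionSection_mem_chartNodeGrading_zero`). Then every `v ∈ W` off `D(z₀)` and off `D(z₁)` (residual sections
`E z₀ = u₀′^{n₀}/c`, `E z₁ = t̂ⁿ/c`) lies in `D(tr)` — hence (✓`mem_blowupChart_of_mem_basicOpen_of_mul_appLE_eq`) in the chart `[N(x₁)]`.
[OURS · L1 W4.5c · R4c `cusp_killsIn_two` COVER (b) at `O`] -/
theorem cuspO_mem_basicOpen_transition_of_residual [NeZero p]
    {n₁ n₂ : ℕ} (hn₂ : 0 < n₂)
    (hc1 : (coverElement 𝒜 (fun i => algebraMap (MvPolynomial (Fin 4) k) (Localization.Away hh) (X ((![0, 1, 2] : Fin 3 → Fin 4) i))) (![9, 2, 3] : Fin 3 → ℕ) dbar y' hy') = (∏ l : ZMod p, ((cobordantAlgebra.u' (fun i => algebraMap (MvPolynomial (Fin 4) k) (Localization.Away hh) (X ((![0, 1, 2] : Fin 3 → Fin 4) i))) (![9, 2, 3] : Fin 3 → ℕ) 1) + algebraMap (Localization.Away hh) ↥(cobordantAlgebra (fun i => algebraMap (MvPolynomial (Fin 4) k) (Localization.Away hh) (X ((![0, 1, 2] :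 Fin 3 → Fin 4) i))) (![9, 2, 3] : Fin 3 → ℕ)) (l.val : (Localization.Away hh)) * ((cobordantAlgebra.u' (fun i => algebraMap (MvPolynomial (Fin 4) k) (Localization.Away hh) (X ((![0, 1, 2] : Fin 3 → Fin 4) i))) (![9, 2, 3] : Fin 3 → ℕ) 0) * (cobordantAlgebra.s (fun i => algebraMap (MvPolynomial (Fin 4) k) (Localization.Away hh) (X ((![0, 1, 2] : Fin 3 → Fin 4) i))) (![9, 2, 3] : Fin 3 → ℕ)) ^ ((![9, 2, 3] : Fin 3 → ℕ) 0 - (![9, 2, 3] : Fin 3 → ℕ) 1)))) ^ n₁)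
    (hc2 : (coverElement 𝒜 (fun i => algebraMap (MvPolynomial (Fin 4) k) (Localization.Away hh) (X ((![0, 1, 2] : Fin 3 → Fin 4) i))) (![9, 2, 3] : Fin 3 → ℕ) dbar y hy) = (∏ l : ZMod p, ((cobordantAlgebra.u' (fun i => algebraMap (MvPolynomial (Fin 4) k) (Localization.Away hh) (X ((![0, 1, 2] : Fin 3 → Fin 4) i))) (![9, 2, 3] : Fin 3 → ℕ) 2) + algebraMap (Localization.Away hh) ↥(cobordantAlgebra (fun i => algebraMap (MvPolynomial (Fin 4) k) (Localization.Away hh) (X ((![0, 1, 2] : Fin 3 → Fin 4) i))) (![9, 2, 3] : Fin 3 → ℕ)) (l.val : (Localization.Away hh)) * ((cobordantAlgebra.u' (fun i => algebraMap (MvPolynomial (Fin 4) k) (Localization.Away hh) (X ((![0, 1, 2] : Fin 3 → Fin 4) i))) (![9, 2, 3] : Fin 3 → ℕ) 0) * (cobordantAlgebra.s (fun i => algebraMap (MvPolynomial (Fin 4) k) (Localization.Away hh) (X ((![0, 1, 2] : Fin 3 → Fin 4) i))) (![9, 2, 3] : Fin 3 → ℕ)) ^ ((![9, 2, 3] : Fin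 3 → ℕ) 0 - (![9, 2, 3] : Fin 3 → ℕ) 2)))) ^ n₂)
    {V : Scheme.{0}} {W : V.Opens} (hW : IsAffineOpen W)
    (E : letI := chartNodeGradedRing mo 𝒜 (fun i => algebraMap (MvPolynomial (Fin 4) k) (Localization.Away hh) (X ((![0, 1, 2] : Fin 3 → Fin 4) i))) (![9, 2, 3] : Fin 3 → ℕ) hf dbar y hy; Γ(V, W) ≃+* ↥((chartNodeGrading mo 𝒜 (fun i => algebraMap (MvPolynomial (Fin 4) k) (Localization.Away hh) (X ((![0, 1, 2] : Fin 3 → Fin 4) i))) (![9, 2, 3] : Fin 3 → ℕ) hf dbar y hy) 0))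
    (tr : Γ(V, W))
    (hEtr : letI := chartNodeGradedRing mo 𝒜 (fun i => algebraMap (MvPolynomial (Fin 4) k) (Localization.Away hh) (X ((![0, 1, 2] : Fin 3 → Fin 4) i))) (![9, 2, 3] : Fin 3 → ℕ) hf dbar y hy; ((E tr : ↥((chartNodeGrading mo 𝒜 (fun i => algebraMap (MvPolynomial (Fin 4) k) (Localization.Away hh) (X ((![0, 1, 2] : Fin 3 → Fin 4) i))) (![9, 2, 3] : Fin 3 → ℕ) hf dbar y hy) 0)) : (ChartRing 𝒜 (fun i => algebraMap (MvPolynomial (Fin 4) k) (Localization.Away hh) (X ((![0, 1, 2] : Fin 3 → Fin 4) i))) (![9, 2, 3] : Fin 3 → ℕ) dbar y hy)) = (algebraMap ↥(cobordantAlgebra (fun i => algebraMap (MvPolynomial (Fin 4) k) (Localization.Away hh) (X ((![0, 1, 2] : Fin 3 → Fin 4) i))) (![9, 2, 3] : Fin 3 → ℕ)) (ChartRing 𝒜 (fun i => algebraMap (MvPolynomial (Fin 4) k) (Localization.Away hh) (X ((![0, 1, 2] : Fin 3 → Fin 4) i))) (![9, 2, 3] : Fin 3 → ℕ) dbar y hy))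 (coverElement 𝒜 (fun i => algebraMap (MvPolynomial (Fin 4) k) (Localization.Away hh) (X ((![0, 1, 2] : Fin 3 → Fin 4) i))) (![9, 2, 3] : Fin 3 → ℕ) dbar y' hy') * IsLocalization.Away.invSelf (coverElement 𝒜 (fun i => algebraMap (MvPolynomial (Fin 4) k) (Localization.Away hh) (X ((![0, 1, 2] : Fin 3 → Fin 4) i))) (![9, 2, 3] : Fin 3 → ℕ) dbar y hy))
    {n₀ n : ℕ} (hn₀ : 0 < n₀) (hn : 0 < n)
    (hZ0 : letI := chartNodeGradedRing mo 𝒜 (fun i => algebraMap (MvPolynomial (Fin 4) k) (Localization.Away hh) (X ((![0, 1, 2] : Fin 3 → Fin 4) i))) (![9, 2, 3] : Fin 3 → ℕ) hf dbar y hy; (algebraMap ↥(cobordantAlgebra (fun i => algebraMap (MvPolynomial (Fin 4) k) (Localization.Away hh) (X ((![0, 1, 2] : Fin 3 → Fin 4) i))) (![9, 2, 3] : Fin 3 → ℕ)) (ChartRing 𝒜 (fun i => algebraMap (MvPolynomial (Fin 4) k) (Localization.Away hh) (X ((![0, 1, 2] : Fin 3 → Fin 4) i))) (![9, 2, 3]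 : Fin 3 → ℕ) dbar y hy)) ((cobordantAlgebra.u' (fun i => algebraMap (MvPolynomial (Fin 4) k) (Localization.Away hh) (X ((![0, 1, 2] : Fin 3 → Fin 4) i))) (![9, 2, 3] : Fin 3 → ℕ) 0) ^ n₀) * IsLocalization.Away.invSelf (coverElement 𝒜 (fun i => algebraMap (MvPolynomial (Fin 4) k) (Localization.Away hh) (X ((![0, 1, 2] : Fin 3 → Fin 4) i))) (![9, 2, 3] : Fin 3 → ℕ) dbar y hy) ∈ (chartNodeGrading mo 𝒜 (fun i => algebraMap (MvPolynomial (Fin 4) k) (Localization.Away hh) (X ((![0, 1, 2] : Fin 3 → Fin 4) i))) (![9, 2, 3] : Fin 3 → ℕ) hf dbar y hy) 0)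
    (hZ1 : letI := chartNodeGradedRing mo 𝒜 (fun i => algebraMap (MvPolynomial (Fin 4) k) (Localization.Away hh) (X ((![0, 1, 2] : Fin 3 → Fin 4) i))) (![9, 2, 3] : Fin 3 → ℕ) hf dbar y hy; (algebraMap ↥(cobordantAlgebra (fun i => algebraMap (MvPolynomial (Fin 4) k) (Localization.Away hh) (X ((![0, 1, 2] : Fin 3 → Fin 4) i))) (![9, 2, 3] : Fin 3 → ℕ)) (ChartRing 𝒜 (fun i => algebraMap (MvPolynomial (Fin 4) k) (Localization.Away hh) (X ((![0, 1, 2] : Fin 3 → Fin 4) i))) (![9, 2, 3] : Fin 3 → ℕ) dbar y hy)) (((⟨_, C_mul_T_mem_cobordantAlgebra _ _ ht⟩ : ↥(cobordantAlgebra (fun i => algebraMap (MvPolynomial (Fin 4) k) (Localization.Away hh) (X ((![0, 1, 2] : Fin 3 → Fin 4) i))) (![9, 2, 3] : Fin 3 → ℕ)))) ^ n) * IsLocalization.Away.invSelf (coverElement 𝒜 (fun i => algebraMap (MvPolynomial (Fin 4) k) (Localization.Away hh) (X ((![0, 1, 2] : Fin 3 → Fin 4) i))) (![9, 2, 3] :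 Fin 3 → ℕ) dbar y hy) ∈ (chartNodeGrading mo 𝒜 (fun i => algebraMap (MvPolynomial (Fin 4) k) (Localization.Away hh) (X ((![0, 1, 2] : Fin 3 → Fin 4) i))) (![9, 2, 3] : Fin 3 → ℕ) hf dbar y hy) 0)
    {v : V} (hv : v ∈ W)
    (hv0 : letI := chartNodeGradedRing mo 𝒜 (fun i => algebraMap (MvPolynomial (Fin 4) k) (Localization.Away hh) (X ((![0, 1, 2] : Fin 3 → Fin 4) i))) (![9, 2, 3] : Fin 3 → ℕ) hf dbar y hy; v ∉ V.basicOpen (E.symm ⟨_, hZ0⟩))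
    (hv1 : letI := chartNodeGradedRing mo 𝒜 (fun i => algebraMap (MvPolynomial (Fin 4) k) (Localization.Away hh) (X ((![0, 1, 2] : Fin 3 → Fin 4) i))) (![9, 2, 3] : Fin 3 → ℕ) hf dbar y hy; v ∉ V.basicOpen (E.symm ⟨_, hZ1⟩)) :
    v ∈ V.basicOpen tr := by
  letI instN := chartNodeGradedRing mo 𝒜 (fun i => algebraMap (MvPolynomial (Fin 4) k) (Localization.Away hh) (X ((![0, 1, 2] : Fin 3 → Fin 4) i))) (![9, 2, 3] : Fin 3 → ℕ) hf dbar y hy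
  have he6 : (![9, 2, 3] : Fin 3 → ℕ) 0 - (![9, 2, 3] : Fin 3 → ℕ) 2 = 6 := by decide
  -- ### the pinned free model of the producer chart ring `[N(x₂)]`
  have hvW : ∀ i : Fin 3, (![9, 2, 3, 0] : Fin 4 → ℕ) ((![0, 1, 2] : Fin 3 → Fin 4) i) = (![9, 2, 3] : Fin 3 → ℕ) i := fun i => by fin_cases i <;> rfl
  have hWv : ∀ l : Fin 4, (![9, 2, 3, 0] : Fin 4 → ℕ) l = 0 ∨ ∃ i : Fin 3, (![0, 1, 2] : Fin 3 → Fin 4) i = l := fun l => by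
    fin_cases l
    exacts [Or.inr ⟨0, rfl⟩, Or.inr ⟨1, rfl⟩, Or.inr ⟨2, rfl⟩, Or.inl rfl]
  have hz : ∀ Ψ : ↥(cobordantAlgebra (fun i => algebraMap (MvPolynomial (Fin 4) k) (Localization.Away hh) (X ((![0, 1, 2] : Fin 3 → Fin 4) i))) (![9, 2, 3] : Fin 3 → ℕ)) ≃+* Localization.Away (cobordantAlgebra.subst k (![9, 2, 3, 0] : Fin 4 → ℕ) hh),
      (∀ a' : (MvPolynomial (Fin 4) k), Ψ (algebraMap (Localization.Away hh) ↥(cobordantAlgebra (fun i => algebraMap (MvPolynomial (Fin 4) k) (Localization.Away hh) (X ((![0, 1, 2] : Fin 3 → Fin 4) i))) (![9, 2, 3] : Fin 3 → ℕ)) (algebraMap (MvPolynomial (Fin 4) k) (Localization.Away hh) a')) = algebraMap (MvPolynomial (Option (Fin 4)) k) _ (cobordantAlgebra.subst k (![9, 2, 3, 0] : Fin 4 → ℕ) a')) →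
      Ψ (cobordantAlgebra.s (fun i => algebraMap (MvPolynomial (Fin 4) k) (Localization.Away hh) (X ((![0, 1, 2] : Fin 3 → Fin 4) i))) (![9, 2, 3] : Fin 3 → ℕ)) = algebraMap (MvPolynomial (Option (Fin 4)) k) _ (X none) →
      (∀ i, Ψ (cobordantAlgebra.u' (fun i => algebraMap (MvPolynomial (Fin 4) k) (Localization.Away hh) (X ((![0, 1, 2] : Fin 3 → Fin 4) i))) (![9, 2, 3] : Fin 3 → ℕ) i) = algebraMap (MvPolynomial (Option (Fin 4)) k) _ (X (some ((![0, 1, 2] : Fin 3 → Fin 4) i)))) →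
      Associated (algebraMap (MvPolynomial (Option (Fin 4)) k) (Localization.Away (cobordantAlgebra.subst k (![9, 2, 3, 0] : Fin 4 → ℕ) hh)) ((∏ l : ZMod p, (X (some 2) + (l.val : (MvPolynomial (Option (Fin 4)) k)) * (X none ^ 6 * X (some 0)))) ^ n₂)) (Ψ (coverElement 𝒜 (fun i => algebraMap (MvPolynomial (Fin 4) k) (Localization.Away hh) (X ((![0, 1, 2] : Fin 3 → Fin 4) i))) (![9, 2, 3] : Fin 3 → ℕ) dbar y hy)) := by
    intro Ψ hΨa hΨs hΨu
    have heq : Ψ (coverElement 𝒜 (fun i => algebraMap (MvPolynomial (Fin 4) k) (Localization.Away hh) (X ((![0, 1, 2] : Fin 3 → Fin 4) i))) (![9, 2, 3] : Fin 3 → ℕ) dbar y hy) = algebraMap (MvPolynomial (Option (Fin 4)) k) (Localization.Away (cobordantAlgebra.subst k (![9, 2, 3, 0] : Fin 4 → ℕ) hh)) ((∏ l : ZMod p, (X (some 2) + (l.val : (MvPolynomial (Option (Fin 4)) k)) * (X none ^ 6 * X (some 0)))) ^ n₂) := by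
      rw [hc2, he6, map_pow, map_prod, map_pow, map_prod]
      refine congrArg (· ^ n₂) (Finset.prod_congr rfl fun l _ => ?_)
      simp only [map_add, map_mul, map_pow, map_natCast, hΨu 2, hΨu 0, hΨs, Matrix.cons_val_two, Matrix.cons_val_zero, Matrix.tail_cons, Matrix.head_cons]
      ring
    rw [heq]
  obtain ⟨Φ, hΦa, hΦs, hΦu⟩ := FreeModel.exists_chartFreeModelEquiv k (![9, 2, 3, 0] : Fin 4 → ℕ) hh (![0, 1, 2] : Fin 3 → Fin 4) (![9, 2, 3] : Fin 3 → ℕ) hvW hWv (fun i => algebraMap (MvPolynomial (Fin 4) k) (Localization.Away hh) (X ((![0, 1, 2] : Fin 3 → Fin 4) i))) (fun _ => rfl) 𝒜 dbar y hy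
    ((∏ l : ZMod p, (X (some 2) + (l.val : (MvPolynomial (Option (Fin 4)) k)) * (X none ^ 6 * X (some 0)))) ^ n₂) hz
  -- ### the unit `N(x₂′)` of the model
  have hUq := IsLocalization.Away.algebraMap_isUnit (S := Localization.Away ((cobordantAlgebra.subst k (![9, 2, 3, 0] : Fin 4 → ℕ) hh) * (∏ l : ZMod p, (X (some 2) + (l.val : (MvPolynomial (Option (Fin 4)) k)) * (X none ^ 6 * X (some 0)))) ^ n₂)) ((cobordantAlgebra.subst k (![9, 2, 3, 0] : Fin 4 → ℕ) hh) * (∏ l : ZMod p, (X (some 2) + (l.val : (MvPolynomial (Option (Fin 4)) k)) * (X none ^ 6 * X (some 0)))) ^ n₂)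
  rw [map_mul] at hUq
  have hUN2 := isUnit_of_mul_isUnit_right hUq
  rw [map_pow, isUnit_pow_iff hn₂.ne'] at hUN2
  -- ### points as primes of the chart ring
  refine BlowupCharts.mem_basicOpen_of_forall_isPrime hW (chartNodeGrading mo 𝒜 (fun i => algebraMap (MvPolynomial (Fin 4) k) (Localization.Away hh) (X ((![0, 1, 2] : Fin 3 → Fin 4) i))) (![9, 2, 3] : Fin 3 → ℕ) hf dbar y hy) E hv (E.symm ⟨_, hZ0⟩) (E.symm ⟨_, hZ1⟩) tr ?_ hv0 hv1
  intro Q hQ hm0 hm1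
  rw [RingEquiv.apply_symm_apply] at hm0 hm1
  haveI := hQ
  have hq0 : (cobordantAlgebra.subst k (![9, 2, 3, 0] : Fin 4 → ℕ) hh) * (∏ l : ZMod p, (X (some 2) + (l.val : (MvPolynomial (Option (Fin 4)) k)) * (X none ^ 6 * X (some 0)))) ^ n₂ ≠ 0 := by
    intro hq
    haveI : Subsingleton (Localization.Away ((cobordantAlgebra.subst k (![9, 2, 3, 0] : Fin 4 → ℕ) hh) * (∏ l : ZMod p, (X (some 2) + (l.val : (MvPolynomial (Option (Fin 4)) k)) * (X none ^ 6 * X (some 0)))) ^ n₂)) :=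
      (IsLocalization.uniqueOfZeroMem (M := Submonoid.powers ((cobordantAlgebra.subst k (![9, 2, 3, 0] : Fin 4 → ℕ) hh) * (∏ l : ZMod p, (X (some 2) + (l.val : (MvPolynomial (Option (Fin 4)) k)) * (X none ^ 6 * X (some 0)))) ^ n₂))
        (S := Localization.Away ((cobordantAlgebra.subst k (![9, 2, 3, 0] : Fin 4 → ℕ) hh) * (∏ l : ZMod p, (X (some 2) + (l.val : (MvPolynomial (Option (Fin 4)) k)) * (X none ^ 6 * X (some 0)))) ^ n₂)) (hq ▸ Submonoid.mem_powers _)).instSubsingleton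
    haveI : Subsingleton (ChartRing 𝒜 (fun i => algebraMap (MvPolynomial (Fin 4) k) (Localization.Away hh) (X ((![0, 1, 2] : Fin 3 → Fin 4) i))) (![9, 2, 3] : Fin 3 → ℕ) dbar y hy) := Φ.toEquiv.subsingleton
    exact hQ.ne_top (Q.eq_top_of_isUnit_mem (Q.zero_mem) (isUnit_of_subsingleton _))
  rw [hEtr]
  exact cuspO_transitionSection_not_mem_of_residualSections (hh := hh) (ht := ht) (mo := mo) (𝒜 := 𝒜) (y := y) (hy := hy) (y' := y') (hy' := hy') hq0 Φ hΦa hΦs hΦu hUN2 hc1 Q hn₀ hn hm0 hm1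

end Summit.ResolutionOfSingularities.ResolutionOfSingularities.Theorems.WildQuotientResolution.S1.KillCert.QhSym

end
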